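import Literature.Algebra.Polynomial.CasasAlvero.Char79Digits
import Literature.Algebra.Polynomial.CasasAlvero.Hexanomial
import Literature.Algebra.Polynomial.CasasAlvero.Degree6CandidatesPrime
import Literature.Algebra.Polynomial.CasasAlvero.Degree5
import Literature.Algebra.Polynomial.CasasAlvero.DigitReduction
import HarnessLib

/-!
# Casas-Alvero degrees in characteristic 79: the complete classification

Over EVERY field `K` of characteristic `79`: `CA_d(K) ⟺ d = 0 ∨ d = a·79^k` with `1 ≤ a ≤ 6`.
Ingredients: the digit reduction `CA_d ⇒ d = a·p^k ∧ CA_a` (`DigitReduction.lean`, any field); the positive digits `1, 2, 3, 4`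
([GrafVonBothmerEtAl2007, Props. 2, 6]), `5` (`Degree5.lean`) and `6` (`79` is not among the `54` candidate bad primes of degree `6` of `Degree6CandidatesPrime.lean`, so `CA_6` holds in characteristic `79` —
a GOOD prime for degree `6` [CastryckLaterveerOunaies2012, Thm. 4] — and `CA_{6·p^k}` descends from the algebraic closure); and a refutation of every digit `7 ≤ a ≤ 78` over every field of characteristic `79`:
`7` by the sparse `𝔽_79`-septic of `Char79Digits.lean` (the degree-7 table of `BadDegrees.lean` stops at `61`); `8` by the
`𝔽_79`-hexanomial of `Hexanomial.lean` (found by the witness-first linear search, kit job j074355 — the last digit that was missing); `14, 15, 31, 35, 37, 39, 42, 45, 50, 51, 53, 55, 63, 70, 72, 73, 76, 78` by the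
binomial criterion (`m = 6, 5, 6, 12, 4, 12, 19, 4, 19, 12, 6, 12, 25, 6, 8, 10, 11, 2`); and the 52 remaining digits by the sparse `𝔽_79`-examples of `Char79Digits.lean`.
-/

noncomputable section

open Polynomial

namespace Literature.Algebra.Polynomial.CasasAlvero

variable (K : Type*) [Field K] [CharP K 79]

/-- `CA_{6·79^k}` over every field of characteristic `79` (`k = 0`: `CA_6` — `79` is not among the `54` candidate bad primes of degree `6`
of `Degree6CandidatesPrime.lean`, i.e. it is a GOOD prime for degree `6` [CastryckLaterveerOunaies2012, Thm. 4]; then descent from the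
algebraic closure). [cite: GrafVonBothmerEtAl2007, Prop. 6] [cite: CastryckLaterveerOunaies2012, Thm. 4] -/
theorem holdsInDegree_six_mul_pow_of_char_79' (k : ℕ) : HoldsInDegree K (6 * 79 ^ k) := by
  haveI : Fact (Nat.Prime 79) := ⟨by norm_num⟩
  exact holdsInDegree_mul_prime_pow_field K 79 (holdsInDegree_six_of_not_mem (K := AlgebraicClosure K) 79 (by decide)) k

/-- every digit `7 ≤ a < 79` fails: `¬ CA_a` over every field of characteristic `79` — the bad-prime computations of
[cite: CastryckLaterveerOunaies2012, Thm. 4] (degrees `≤ 7`) extended to every digit below `79` by explicit `𝔽_79`-rational examples and the binomial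
criterion. [cite: GrafVonBothmerEtAl2007, Prop. 6] -/
theorem not_holdsInDegree_digit_of_char_seventyNine {a : ℕ} (h7 : 7 ≤ a) (hap : a < 79) : ¬ HoldsInDegree K a := by
  haveI : Fact (Nat.Prime 79) := ⟨by norm_num⟩
  interval_cases a
  · exact not_holdsInDegree_seven_of_char_79 K
  · exact not_holdsInDegree_eight_of_char_79 K
  · exact not_holdsInDegree_nine_of_char_79 K
  · exact not_holdsInDegree_ten_of_char_79 K
  · exact not_holdsInDegree_eleven_of_char_79 K
  · exact not_holdsInDegree_twelve_of_char_79 K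
  · exact not_holdsInDegree_thirteen_of_char_79 K
  · exact not_holdsInDegree_of_choose_modEq_one K 79 (d := 14) (m := 6) (by norm_num) (by norm_num) (by decide)
  · exact not_holdsInDegree_of_choose_modEq_one K 79 (d := 15) (m := 5) (by norm_num) (by norm_num) (by decide)
  · exact not_holdsInDegree_sixteen_of_char_79 K
  · exact not_holdsInDegree_seventeen_of_char_79 K
  · exact not_holdsInDegree_eighteen_of_char_79 K
  · exact not_holdsInDegree_nineteen_of_char_79 K
  · exact not_holdsInDegree_twenty_of_char_79 K
  · exact not_holdsInDegree_twentyOne_of_char_79 K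
  · exact not_holdsInDegree_twentyTwo_of_char_79 K
  · exact not_holdsInDegree_twentyThree_of_char_79 K
  · exact not_holdsInDegree_twentyFour_of_char_79 K
  · exact not_holdsInDegree_twentyFive_of_char_79 K
  · exact not_holdsInDegree_twentySix_of_char_79 K
  · exact not_holdsInDegree_twentySeven_of_char_79 K
  · exact not_holdsInDegree_twentyEight_of_char_79 K
  · exact not_holdsInDegree_twentyNine_of_char_79 K
  · exact not_holdsInDegree_thirty_of_char_79 K
  · exact not_holdsInDegree_of_choose_modEq_one K 79 (d := 31) (m := 6) (by norm_num) (by norm_num) (by decide)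
  · exact not_holdsInDegree_thirtyTwo_of_char_79 K
  · exact not_holdsInDegree_thirtyThree_of_char_79 K
  · exact not_holdsInDegree_thirtyFour_of_char_79 K
  · exact not_holdsInDegree_of_choose_modEq_one K 79 (d := 35) (m := 12) (by norm_num) (by norm_num) (by decide)
  · exact not_holdsInDegree_thirtySix_of_char_79 K
  · exact not_holdsInDegree_of_choose_modEq_one K 79 (d := 37) (m := 4) (by norm_num) (by norm_num) (by decide)
  · exact not_holdsInDegree_thirtyEight_of_char_79 K
  · exact not_holdsInDegree_of_choose_modEq_one K 79 (d := 39) (m := 12) (by norm_num) (by norm_num) (by decide)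
  · exact not_holdsInDegree_forty_of_char_79 K
  · exact not_holdsInDegree_fortyOne_of_char_79 K
  · exact not_holdsInDegree_of_choose_modEq_one K 79 (d := 42) (m := 19) (by norm_num) (by norm_num) (by decide)
  · exact not_holdsInDegree_fortyThree_of_char_79 K
  · exact not_holdsInDegree_fortyFour_of_char_79 K
  · exact not_holdsInDegree_of_choose_modEq_one K 79 (d := 45) (m := 4) (by norm_num) (by norm_num) (by decide)
  · exact not_holdsInDegree_fortySix_of_char_79 K
  · exact not_holdsInDegree_fortySeven_of_char_79 K
  · exact not_holdsInDegree_fortyEight_of_char_79 K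
  · exact not_holdsInDegree_fortyNine_of_char_79 K
  · exact not_holdsInDegree_of_choose_modEq_one K 79 (d := 50) (m := 19) (by norm_num) (by norm_num) (by decide)
  · exact not_holdsInDegree_of_choose_modEq_one K 79 (d := 51) (m := 12) (by norm_num) (by norm_num) (by decide)
  · exact not_holdsInDegree_fiftyTwo_of_char_79 K
  · exact not_holdsInDegree_of_choose_modEq_one K 79 (d := 53) (m := 6) (by norm_num) (by norm_num) (by decide)
  · exact not_holdsInDegree_fiftyFour_of_char_79 K
  · exact not_holdsInDegree_of_choose_modEq_one K 79 (d := 55) (m := 12) (by norm_num) (by norm_num) (by decide)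
  · exact not_holdsInDegree_fiftySix_of_char_79 K
  · exact not_holdsInDegree_fiftySeven_of_char_79 K
  · exact not_holdsInDegree_fiftyEight_of_char_79 K
  · exact not_holdsInDegree_fiftyNine_of_char_79 K
  · exact not_holdsInDegree_sixty_of_char_79 K
  · exact not_holdsInDegree_sixtyOne_of_char_79 K
  · exact not_holdsInDegree_sixtyTwo_of_char_79 K
  · exact not_holdsInDegree_of_choose_modEq_one K 79 (d := 63) (m := 25) (by norm_num) (by norm_num) (by decide)
  · exact not_holdsInDegree_sixtyFour_of_char_79 K
  · exact not_holdsInDegree_sixtyFive_of_char_79 K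
  · exact not_holdsInDegree_sixtySix_of_char_79 K
  · exact not_holdsInDegree_sixtySeven_of_char_79 K
  · exact not_holdsInDegree_sixtyEight_of_char_79 K
  · exact not_holdsInDegree_sixtyNine_of_char_79 K
  · exact not_holdsInDegree_of_choose_modEq_one K 79 (d := 70) (m := 6) (by norm_num) (by norm_num) (by decide)
  · exact not_holdsInDegree_seventyOne_of_char_79 K
  · exact not_holdsInDegree_of_choose_modEq_one K 79 (d := 72) (m := 8) (by norm_num) (by norm_num) (by decide)
  · exact not_holdsInDegree_of_choose_modEq_one K 79 (d := 73) (m := 10) (by norm_num) (by norm_num) (by decide)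
  · exact not_holdsInDegree_seventyFour_of_char_79 K
  · exact not_holdsInDegree_seventyFive_of_char_79 K
  · exact not_holdsInDegree_of_choose_modEq_one K 79 (d := 76) (m := 11) (by norm_num) (by norm_num) (by decide)
  · exact not_holdsInDegree_seventySeven_of_char_79 K
  · exact not_holdsInDegree_of_choose_modEq_one K 79 (d := 78) (m := 2) (by norm_num) (by norm_num) (by decide)

/-- the positive digits `1 ≤ a ≤ 5`: `CA_{a·79^k}` over every field of characteristic `79`. [cite: GrafVonBothmerEtAl2007, Props. 2, 6]
[cite: CastryckLaterveerOunaies2012, Thm. 4] -/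
theorem holdsInDegree_mul_seventyNine_pow_of_le_five {a : ℕ} (ha0 : 0 < a) (ha5 : a ≤ 5) (k : ℕ) :
    HoldsInDegree K (a * 79 ^ k) := by
  haveI : Fact (Nat.Prime 79) := ⟨by norm_num⟩
  interval_cases a
  · simpa using holdsInDegree_prime_pow_field K 79 k
  · exact holdsInDegree_two_mul_prime_pow_field K 79 k
  · exact holdsInDegree_three_mul_prime_pow_field K 79 (by norm_num) k
  · exact holdsInDegree_mul_prime_pow_field K 79
      (holdsInDegree_of_le_four_of_charP (AlgebraicClosure K) 79 (by norm_num) le_rfl) k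
  · exact holdsInDegree_five_mul_prime_pow_field K 79 (by norm_num) (by norm_num) (by norm_num) (by norm_num)
      (by norm_num) (by norm_num) (by norm_num) (by norm_num) (by norm_num) k

/-- **characteristic 79, complete**: over every field of characteristic `79`,
`CA_d ⟺ d = 0 ∨ d = a·79^k` with `1 ≤ a ≤ 6`. [cite: GrafVonBothmerEtAl2007, Props. 2, 6, 7]
[cite: CastryckLaterveerOunaies2012, Thm. 4] -/
theorem classification_char_seventyNine_complete (d : ℕ) :
    HoldsInDegree K d ↔ d = 0 ∨ ∃ k a : ℕ, 0 < a ∧ a ≤ 6 ∧ d = a * 79 ^ k := by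
  haveI : Fact (Nat.Prime 79) := ⟨by norm_num⟩
  constructor
  · intro h
    rcases Nat.eq_zero_or_pos d with rfl | hd
    · exact Or.inl rfl
    obtain ⟨k, a, ha0, hap, rfl, ha⟩ := digit_of_holdsInDegree K 79 hd.ne' h
    refine Or.inr ⟨k, a, ha0, ?_, rfl⟩
    by_contra h6
    exact not_holdsInDegree_digit_of_char_seventyNine K (by omega) hap ha
  · rintro (rfl | ⟨k, a, ha0, ha6, rfl⟩)
    · exact holdsInDegree_zero K
    · rcases Nat.lt_or_ge a 6 with ha | ha
      · exact holdsInDegree_mul_seventyNine_pow_of_le_five K ha0 (by omega) k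
      · obtain rfl : a = 6 := le_antisymm ha6 ha
        exact holdsInDegree_six_mul_pow_of_char_79' K k

/-- the set of Casas-Alvero degrees `≤ 6241` in characteristic `79`, explicitly (corollary of the classification:
[cite: GrafVonBothmerEtAl2007, Prop. 6] with [cite: CastryckLaterveerOunaies2012, Thm. 4] and the digit refutations above). -/
theorem holdsInDegree_iff_mem_of_le_char_seventyNine_sq {d : ℕ} (hd : d ≤ 6241) :
    HoldsInDegree K d ↔ d ∈ ({0, 1, 2, 3, 4, 5, 6, 79, 158, 237, 316, 395, 474, 6241} : Finset ℕ) := by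
  rw [classification_char_seventyNine_complete]
  constructor
  · rintro (rfl | ⟨k, a, ha0, ha6, rfl⟩)
    · decide
    · rcases k with _ | _ | _ | k
      · interval_cases a <;> decide
      · interval_cases a <;> decide
      · interval_cases a <;> simp_all
      · exfalso
        have : 79 ^ 3 ≤ a * 79 ^ (k + 1 + 1 + 1) :=
          le_trans (Nat.pow_le_pow_right (by norm_num) (by omega)) (Nat.le_mul_of_pos_left _ ha0)
        omega
  · intro h
    simp only [Finset.mem_insert, Finset.mem_singleton] at h
    rcases h with rfl | rfl | rfl | rfl | rfl | rfl | rfl | rfl | rfl | rfl | rfl | rfl | rfl | rfl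
    · exact Or.inl rfl
    · exact Or.inr ⟨0, 1, by norm_num, by norm_num, by norm_num⟩
    · exact Or.inr ⟨0, 2, by norm_num, by norm_num, by norm_num⟩
    · exact Or.inr ⟨0, 3, by norm_num, by norm_num, by norm_num⟩
    · exact Or.inr ⟨0, 4, by norm_num, by norm_num, by norm_num⟩
    · exact Or.inr ⟨0, 5, by norm_num, by norm_num, by norm_num⟩
    · exact Or.inr ⟨0, 6, by norm_num, by norm_num, by norm_num⟩
    · exact Or.inr ⟨1, 1, by norm_num, by norm_num, by norm_num⟩
    · exact Or.inr ⟨1, 2, by norm_num, by norm_num, by norm_num⟩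
    · exact Or.inr ⟨1, 3, by norm_num, by norm_num, by norm_num⟩
    · exact Or.inr ⟨1, 4, by norm_num, by norm_num, by norm_num⟩
    · exact Or.inr ⟨1, 5, by norm_num, by norm_num, by norm_num⟩
    · exact Or.inr ⟨1, 6, by norm_num, by norm_num, by norm_num⟩
    · exact Or.inr ⟨2, 1, by norm_num, by norm_num, by norm_num⟩

end Literature.Algebra.Polynomial.CasasAlvero
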